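import Literature.AlgebraicGeometry.Frobenioids.Cor54SubOneUniqueProofs
import HarnessLib

/-!
# Frobenioids I, Corollary 5.4 (strong 1-uniqueness at THE data): hom-rigidity of `C^un-tr → C^rlf` —
# generic model-Frobenioid lemmas (sub-DAG row C54-core-arith, file 4a)

Mochizuki, *The geometry of Frobenioids I: the general theory*, Kyushu J. Math. **62** (2008) 293–400,
Corollary 5.4 p. 104; Theorem 5.2 (i) p. 100 (the model Frobenioid: objects `(A_D, α)`, morphisms
`(deg_Fr, Base, Div, u)` subject to relation (d)); Proposition 5.3 p. 103 (`C^un-tr → C^rlf`).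
[cite: MochizukiFrdI2008, Cor. 5.4 p.104]

PROOF-ONLY file (seat abc-iut-w5-d048, L1-lead R111 (2)/R114a; no definitions). For ANY realification datum
`R : RealificationData Φ` and subfunctor of groups `Ψ ⊆ Φ^gp` let `G := R.toRlfModel Ψ` (model of `(Φ, Ψ)` → model
of `(Φ^rlf, ℝ · Ψ)`; for `Ψ = Φ^birat` and THE `R` this is `untrToRlf : C^un-tr → C^rlf`); on objects
`G (A, μ) = (A, ι^gp μ)` ON THE NOSE, `ι^gp = gpApp R.toRlf`. HOM-RIGIDITY of `G` (input (b′) of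
`FrdI.Cor54Sub.rigidAlong_of_essSurj_of_homRigid`, file 1) asks that every functorial self-map `ρ` of the morphisms
between `G`-image objects fixing the `G k` be the identity. This file reduces it to the morphisms of FROBENIUS
DEGREE `1` OVER THE IDENTITY of one base object and records the conjugation identity used to pin those:

* `exists_divHom` / `exists_frobHom` / `exists_pullHom` — the morphisms `(1, id, w, 0)`, `(d, id, 0, 0)`,
  `(1, f, 0, 0)` of the model of `(Φ, Ψ)` (Thm. 5.2 (i)); `toRlfModel_map_*` — components of `G k`;
* **`exists_factorisation`** — every `h = (d, f, z, u) : G a ⟶ G a'` factors as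
  `G(d, id, 0, 0) ≫ (1, id, z, u) ≫ G(1, f, 0, 0)` through IMAGE objects;
* **`homRigid_of_baseId`** — hence `ρ = id` as soon as `ρ K = K` for every `K : G(A, μ) ⟶ G(A, ν)` with
  `deg_Fr K = 1`, `Base K = id_A`;
* `exists_divHom_conj` + `components_of_conj` — conjugating such a `K` by the image morphisms `G(1, id, w, 0)`
  and reading off `(deg_Fr, Base, Div)` from `G z_μ ≫ k' = k ≫ G z_ν`.

Pure algebra of Thm. 5.2 (i); nothing here bears on [IUTchIII] Cor. 3.12.
-/

noncomputable section

namespace Literature.AlgebraicGeometry.Frobenioids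

namespace FrdI.Cor54Sub

open CategoryTheory Opposite ModelFrobenioid

universe w v u

variable {D : Type u} [Category.{v} D] {Φ : Dᵒᵖ ⥤ CommMonCat.{w}} (R : RealificationData Φ)
  (Ψ : GpSubfunctor Φ)

/-! ### Elementary morphisms of the model of `(Φ, Ψ)` -/

/-- The morphism `(1, id_A, w, 0) : (A, μ) → (A, μ + w)` ("adding the effective divisor `w`").
[cite: MochizukiFrdI2008, Thm. 5.2 (i) p.100] -/
theorem exists_divHom (A : D) (μ : Algebra.GrothendieckGroup (Φ.obj (op A))) (w : Φ.obj (op A)) :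
    ∃ z : (⟨A, μ⟩ : Ψ.ModelOf) ⟶ ⟨A, μ * Algebra.GrothendieckGroup.of w⟩,
      degFr z = 1 ∧ baseMap z = 𝟙 A ∧ div z = w ∧ unit z = 1 :=
  ⟨{ degFr := 1, base := 𝟙 A, div := w, unit := 1,
     rel := by rw [PNat.one_coe, pow_one, map_one, mul_one, pullGp_id] }, rfl, rfl, rfl, rfl⟩

/-- The Frobenius-type morphism `(d, id_A, 0, 0) : (A, μ) → (A, d · μ)`. [cite: MochizukiFrdI2008, Thm. 5.2 (i) p.100] -/
theorem exists_frobHom (A : D) (μ : Algebra.GrothendieckGroup (Φ.obj (op A))) (d : ℕ+) :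
    ∃ fr : (⟨A, μ⟩ : Ψ.ModelOf) ⟶ ⟨A, μ ^ (d : ℕ)⟩,
      degFr fr = d ∧ baseMap fr = 𝟙 A ∧ div fr = 1 ∧ unit fr = 1 :=
  ⟨{ degFr := d, base := 𝟙 A, div := 1, unit := 1,
     rel := by rw [map_one, mul_one, map_one, mul_one, pullGp_id] }, rfl, rfl, rfl, rfl⟩

/-- The pull-back morphism `(1, f, 0, 0) : (A, Φ(f)(μ')) → (A', μ')`. [cite: MochizukiFrdI2008, Thm. 5.2 (i) p.100] -/
theorem exists_pullHom {A A' : D} (f : A ⟶ A') (μ' : Algebra.GrothendieckGroup (Φ.obj (op A'))) :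
    ∃ pb : (⟨A, pullGp Φ f μ'⟩ : Ψ.ModelOf) ⟶ ⟨A', μ'⟩,
      degFr pb = 1 ∧ baseMap pb = f ∧ div pb = 1 ∧ unit pb = 1 :=
  ⟨{ degFr := 1, base := f, div := 1, unit := 1,
     rel := by rw [PNat.one_coe, pow_one, map_one, mul_one, map_one, mul_one] }, rfl, rfl, rfl, rfl⟩

/-! ### Components of `G k` for `G = R.toRlfModel Ψ` (`G (A, μ) = (A, ι^gp μ)` on the nose) -/

/-- The image object `G (A, μ)` is `(A, ι^gp(μ))`. [cite: MochizukiFrdI2008, Prop. 5.3 p.103] -/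
theorem toRlfModel_obj_mk (A : D) (μ : Algebra.GrothendieckGroup (Φ.obj (op A))) :
    (R.toRlfModel Ψ).obj ⟨A, μ⟩ = ⟨A, gpApp (R.ofBaseData Ψ).η (op A) μ⟩ := rfl

/-- `deg_Fr(G k) = deg_Fr(k)`. [cite: MochizukiFrdI2008, Prop. 5.3 p.103] -/
theorem toRlfModel_map_degFr {A A' : D} {μ : Algebra.GrothendieckGroup (Φ.obj (op A))}
    {μ' : Algebra.GrothendieckGroup (Φ.obj (op A'))} (k : (⟨A, μ⟩ : Ψ.ModelOf) ⟶ ⟨A', μ'⟩) :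
    degFr (X := (⟨A, gpApp (R.ofBaseData Ψ).η (op A) μ⟩ : (R.realSpan Ψ).ModelOf)) (Y := ⟨A', gpApp (R.ofBaseData Ψ).η (op A') μ'⟩)
      ((R.toRlfModel Ψ).map k) = degFr k := rfl

/-- `Base(G k) = Base(k)`. [cite: MochizukiFrdI2008, Prop. 5.3 p.103] -/
theorem toRlfModel_map_baseMap {A A' : D} {μ : Algebra.GrothendieckGroup (Φ.obj (op A))}
    {μ' : Algebra.GrothendieckGroup (Φ.obj (op A'))} (k : (⟨A, μ⟩ : Ψ.ModelOf) ⟶ ⟨A', μ'⟩) :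
    baseMap (X := (⟨A, gpApp (R.ofBaseData Ψ).η (op A) μ⟩ : (R.realSpan Ψ).ModelOf)) (Y := ⟨A', gpApp (R.ofBaseData Ψ).η (op A') μ'⟩)
      ((R.toRlfModel Ψ).map k) = baseMap k := rfl

/-- `Div(G k) = ι(Div k)` with `ι : Φ → Φ^rlf`. [cite: MochizukiFrdI2008, Prop. 5.3 p.103] -/
theorem toRlfModel_map_div {A A' : D} {μ : Algebra.GrothendieckGroup (Φ.obj (op A))}
    {μ' : Algebra.GrothendieckGroup (Φ.obj (op A'))} (k : (⟨A, μ⟩ : Ψ.ModelOf) ⟶ ⟨A', μ'⟩) :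
    div (X := (⟨A, gpApp (R.ofBaseData Ψ).η (op A) μ⟩ : (R.realSpan Ψ).ModelOf)) (Y := ⟨A', gpApp (R.ofBaseData Ψ).η (op A') μ'⟩)
      ((R.toRlfModel Ψ).map k) = ((R.ofBaseData Ψ).η.app (op A)).hom (div k) := rfl

/-- `u_{G k} = ι^gp(u_k)` in `(Φ^rlf)^gp`. [cite: MochizukiFrdI2008, Prop. 5.3 p.103] -/
theorem toRlfModel_map_coe_unit {A A' : D} {μ : Algebra.GrothendieckGroup (Φ.obj (op A))}
    {μ' : Algebra.GrothendieckGroup (Φ.obj (op A'))} (k : (⟨A, μ⟩ : Ψ.ModelOf) ⟶ ⟨A', μ'⟩) :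
    (unit (X := (⟨A, gpApp (R.ofBaseData Ψ).η (op A) μ⟩ : (R.realSpan Ψ).ModelOf)) (Y := ⟨A', gpApp (R.ofBaseData Ψ).η (op A') μ'⟩)
      ((R.toRlfModel Ψ).map k)).1 = gpApp (R.ofBaseData Ψ).η (op A) (unit k).1 := rfl

/-! ### Factorisation of a morphism between image objects through image objects -/

/-- **Every morphism `h = (d, f, z, u) : G(A, α) ⟶ G(A', α')` factors as `G(d, id, 0, 0) ≫ (1, id, z, u) ≫ G(1, f, 0, 0)`**
through the IMAGE objects `G(A, d · α)` and `G(A, Φ(f)(α'))` (relation (d) of Thm. 5.2 (i) for the middle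
factor is that of `h`). [cite: MochizukiFrdI2008, Thm. 5.2 (i) p.100] -/
theorem exists_factorisation (A A' : D) (α : Algebra.GrothendieckGroup (Φ.obj (op A)))
    (α' : Algebra.GrothendieckGroup (Φ.obj (op A')))
    (h : (⟨A, gpApp (R.ofBaseData Ψ).η (op A) α⟩ : (R.realSpan Ψ).ModelOf) ⟶ ⟨A', gpApp (R.ofBaseData Ψ).η (op A') α'⟩) :
    ∃ (fr : (⟨A, α⟩ : Ψ.ModelOf) ⟶ ⟨A, α ^ (degFr h : ℕ)⟩)
      (pb : (⟨A, pullGp Φ (baseMap h) α'⟩ : Ψ.ModelOf) ⟶ ⟨A', α'⟩)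
      (H : (⟨A, gpApp (R.ofBaseData Ψ).η (op A) (α ^ (degFr h : ℕ))⟩ : (R.realSpan Ψ).ModelOf) ⟶
        ⟨A, gpApp (R.ofBaseData Ψ).η (op A) (pullGp Φ (baseMap h) α')⟩),
      degFr H = 1 ∧ baseMap H = 𝟙 A ∧ div H = div h ∧ unit H = unit h ∧
        h = (R.toRlfModel Ψ).map fr ≫ H ≫ (R.toRlfModel Ψ).map pb := by
  obtain ⟨fr, hfr₁, hfr₂, hfr₃, hfr₄⟩ := exists_frobHom Ψ A α (degFr h)
  obtain ⟨pb, hpb₁, hpb₂, hpb₃, hpb₄⟩ := exists_pullHom Ψ (baseMap h) α'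
  have hrel : gpApp (R.ofBaseData Ψ).η (op A) α ^ (degFr h : ℕ) * Algebra.GrothendieckGroup.of (div h) =
      pullGp R.rlf (baseMap h) (gpApp (R.ofBaseData Ψ).η (op A') α') * (unit h).1 := by
    have hr := rel h
    dsimp only at hr
    exact hr
  have hrelH : gpApp (R.ofBaseData Ψ).η (op A) (α ^ (degFr h : ℕ)) ^ ((1 : ℕ+) : ℕ) *
        Algebra.GrothendieckGroup.of (div h) =
      pullGp R.rlf (𝟙 A) (gpApp (R.ofBaseData Ψ).η (op A) (pullGp Φ (baseMap h) α')) * (unit h).1 := by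
    rw [PNat.one_coe, pow_one, map_pow, pullGp_id, gpApp_pullGp]
    exact hrel
  -- the middle factor
  let H : (⟨A, gpApp (R.ofBaseData Ψ).η (op A) (α ^ (degFr h : ℕ))⟩ : (R.realSpan Ψ).ModelOf) ⟶
      ⟨A, gpApp (R.ofBaseData Ψ).η (op A) (pullGp Φ (baseMap h) α')⟩ :=
    { degFr := 1, base := 𝟙 A, div := h.div, unit := h.unit, rel := by exact hrelH }
  refine ⟨fr, pb, H, rfl, rfl, rfl, rfl, ?_⟩
  apply PreFrobenioid.Cor54Unique.hom_eq
  · change degFr h = degFr pb * 1 * degFr fr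
    rw [hfr₁, hpb₁, one_mul, one_mul]
  · change baseMap h = baseMap fr ≫ 𝟙 A ≫ baseMap pb
    rw [hfr₂, hpb₂, Category.id_comp, Category.id_comp]
  · have e : (div ((R.toRlfModel Ψ).map fr ≫ H ≫ (R.toRlfModel Ψ).map pb) : R.rlf.obj (op A)) =
        (R.rlf.map (baseMap fr).op).hom ((R.rlf.map (𝟙 A).op).hom (((R.ofBaseData Ψ).η.app (op A)).hom (div pb)) *
          h.div ^ (degFr pb : ℕ)) * ((R.ofBaseData Ψ).η.app (op A)).hom (div fr) ^ ((degFr pb * 1 : ℕ+) : ℕ) := rfl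
    change (div h : R.rlf.obj (op A)) = div ((R.toRlfModel Ψ).map fr ≫ H ≫ (R.toRlfModel Ψ).map pb)
    rw [e, hfr₂, hfr₃, hpb₁, hpb₃]
    simp only [map_one, mul_one, one_mul, PNat.one_coe, pow_one, op_id, CategoryTheory.Functor.map_id,
      CommMonCat.hom_id, MonoidHom.id_apply]

/-- **Reduction of hom-rigidity to Frobenius degree `1` over the identity**: a functorial self-map `ρ` of the
morphisms between `G`-image objects fixing the `G k` is the identity as soon as it fixes every
`K : G(A, μ) ⟶ G(A, ν)` with `deg_Fr K = 1` and `Base K = id_A`. [cite: MochizukiFrdI2008, Cor. 5.4 p.104] -/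
theorem homRigid_of_baseId
    (ρ : ∀ ⦃a a' : Ψ.ModelOf⦄, ((R.toRlfModel Ψ).obj a ⟶ (R.toRlfModel Ψ).obj a') →
      ((R.toRlfModel Ψ).obj a ⟶ (R.toRlfModel Ψ).obj a'))
    (hcomp : ∀ ⦃a a' a'' : Ψ.ModelOf⦄ (h : (R.toRlfModel Ψ).obj a ⟶ (R.toRlfModel Ψ).obj a')
      (k : (R.toRlfModel Ψ).obj a' ⟶ (R.toRlfModel Ψ).obj a''), ρ (h ≫ k) = ρ h ≫ ρ k)
    (hmap : ∀ ⦃a a' : Ψ.ModelOf⦄ (f : a ⟶ a'), ρ ((R.toRlfModel Ψ).map f) = (R.toRlfModel Ψ).map f)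
    (hK : ∀ (A : D) (μ ν : Algebra.GrothendieckGroup (Φ.obj (op A)))
      (K : (⟨A, gpApp (R.ofBaseData Ψ).η (op A) μ⟩ : (R.realSpan Ψ).ModelOf) ⟶ ⟨A, gpApp (R.ofBaseData Ψ).η (op A) ν⟩),
      degFr K = 1 → baseMap K = 𝟙 A → ρ (a := ⟨A, μ⟩) (a' := ⟨A, ν⟩) K = K)
    ⦃a a' : Ψ.ModelOf⦄ (h : (R.toRlfModel Ψ).obj a ⟶ (R.toRlfModel Ψ).obj a') : ρ h = h := by
  obtain ⟨A, α⟩ := a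
  obtain ⟨A', α'⟩ := a'
  obtain ⟨fr, pb, H, hH₁, hH₂, -, -, hfac⟩ := exists_factorisation R Ψ A A' α α' h
  have hρH : ρ (a := ⟨A, α ^ (degFr (X := (⟨A, gpApp (R.ofBaseData Ψ).η (op A) α⟩ : (R.realSpan Ψ).ModelOf))
      (Y := ⟨A', gpApp (R.ofBaseData Ψ).η (op A') α'⟩) h : ℕ)⟩) (a' := ⟨A, pullGp Φ (baseMap
        (X := (⟨A, gpApp (R.ofBaseData Ψ).η (op A) α⟩ : (R.realSpan Ψ).ModelOf)) (Y := ⟨A', gpApp (R.ofBaseData Ψ).η (op A') α'⟩) h) α'⟩)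
      H = H := hK _ _ _ H hH₁ hH₂
  have e1 : ρ ((R.toRlfModel Ψ).map fr ≫ H ≫ (R.toRlfModel Ψ).map pb) =
      ρ ((R.toRlfModel Ψ).map fr) ≫ ρ (H ≫ (R.toRlfModel Ψ).map pb) := hcomp _ _
  have e2 : ρ (a := ⟨A, α ^ (degFr (X := (⟨A, gpApp (R.ofBaseData Ψ).η (op A) α⟩ : (R.realSpan Ψ).ModelOf))
      (Y := ⟨A', gpApp (R.ofBaseData Ψ).η (op A') α'⟩) h : ℕ)⟩) (H ≫ (R.toRlfModel Ψ).map pb) =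
      ρ (a := ⟨A, α ^ (degFr (X := (⟨A, gpApp (R.ofBaseData Ψ).η (op A) α⟩ : (R.realSpan Ψ).ModelOf))
      (Y := ⟨A', gpApp (R.ofBaseData Ψ).η (op A') α'⟩) h : ℕ)⟩) (a' := ⟨A, pullGp Φ (baseMap
        (X := (⟨A, gpApp (R.ofBaseData Ψ).η (op A) α⟩ : (R.realSpan Ψ).ModelOf))
        (Y := ⟨A', gpApp (R.ofBaseData Ψ).η (op A') α'⟩) h) α'⟩) H ≫ ρ ((R.toRlfModel Ψ).map pb) := hcomp _ _
  rw [hfac, e1, e2, hmap, hmap, hρH]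
  rfl

/-! ### Conjugation by the image morphisms `G(1, id, w, 0)` -/

/-- **Conjugation identity.** For `K = (1, id_A, z, u) : G(A, μ) ⟶ G(A, ν)` and an effective `w ∈ Φ(A)`:
`G z_μ ≫ K' = K ≫ G z_ν` with `z_μ = (1, id, w, 0) : (A, μ) → (A, μ + w)`, `z_ν` likewise, and
`K' = (1, id_A, z, u) : G(A, μ + w) ⟶ G(A, ν + w)` (same `Div` and unit).
[cite: MochizukiFrdI2008, Thm. 5.2 (i) p.100] -/
theorem exists_divHom_conj (A : D) (μ ν : Algebra.GrothendieckGroup (Φ.obj (op A)))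
    (K : (⟨A, gpApp (R.ofBaseData Ψ).η (op A) μ⟩ : (R.realSpan Ψ).ModelOf) ⟶ ⟨A, gpApp (R.ofBaseData Ψ).η (op A) ν⟩)
    (hd : degFr K = 1) (hb : baseMap K = 𝟙 A) (w : Φ.obj (op A)) :
    ∃ (zμ : (⟨A, μ⟩ : Ψ.ModelOf) ⟶ ⟨A, μ * Algebra.GrothendieckGroup.of w⟩)
      (zν : (⟨A, ν⟩ : Ψ.ModelOf) ⟶ ⟨A, ν * Algebra.GrothendieckGroup.of w⟩)
      (K' : (⟨A, gpApp (R.ofBaseData Ψ).η (op A) (μ * Algebra.GrothendieckGroup.of w)⟩ : (R.realSpan Ψ).ModelOf) ⟶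
        ⟨A, gpApp (R.ofBaseData Ψ).η (op A) (ν * Algebra.GrothendieckGroup.of w)⟩),
      (degFr zμ = 1 ∧ baseMap zμ = 𝟙 A ∧ div zμ = w ∧ unit zμ = 1) ∧
      (degFr zν = 1 ∧ baseMap zν = 𝟙 A ∧ div zν = w ∧ unit zν = 1) ∧
      (degFr K' = 1 ∧ baseMap K' = 𝟙 A ∧ div K' = div K ∧ unit K' = unit K) ∧
        (R.toRlfModel Ψ).map zμ ≫ K' = K ≫ (R.toRlfModel Ψ).map zν := by
  obtain ⟨zμ, h₁, h₂, h₃, h₄⟩ := exists_divHom Ψ A μ w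
  obtain ⟨zν, h₁', h₂', h₃', h₄'⟩ := exists_divHom Ψ A ν w
  have hrel : gpApp (R.ofBaseData Ψ).η (op A) μ * Algebra.GrothendieckGroup.of (div K) =
      gpApp (R.ofBaseData Ψ).η (op A) ν * (unit K).1 := by
    have hr := rel K
    dsimp only at hr
    rw [hd, hb, PNat.one_coe, pow_one, pullGp_id] at hr
    exact hr
  have hrelK' : gpApp (R.ofBaseData Ψ).η (op A) (μ * Algebra.GrothendieckGroup.of w) ^ ((1 : ℕ+) : ℕ) *
        Algebra.GrothendieckGroup.of (div K) =
      pullGp R.rlf (𝟙 A) (gpApp (R.ofBaseData Ψ).η (op A) (ν * Algebra.GrothendieckGroup.of w)) * (unit K).1 := by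
    rw [PNat.one_coe, pow_one, pullGp_id, map_mul, map_mul, mul_right_comm, hrel, mul_right_comm]
  let K' : (⟨A, gpApp (R.ofBaseData Ψ).η (op A) (μ * Algebra.GrothendieckGroup.of w)⟩ : (R.realSpan Ψ).ModelOf) ⟶
      ⟨A, gpApp (R.ofBaseData Ψ).η (op A) (ν * Algebra.GrothendieckGroup.of w)⟩ :=
    { degFr := 1, base := 𝟙 A, div := K.div, unit := K.unit, rel := by exact hrelK' }
  refine ⟨zμ, zν, K', ⟨h₁, h₂, h₃, h₄⟩, ⟨h₁', h₂', h₃', h₄'⟩, ⟨rfl, rfl, rfl, rfl⟩, ?_⟩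
  apply PreFrobenioid.Cor54Unique.hom_eq
  · change (1 : ℕ+) * degFr zμ = degFr zν * degFr K
    rw [h₁, h₁', hd]
  · change (baseMap zμ : A ⟶ A) ≫ (𝟙 A : A ⟶ A) = (baseMap K : A ⟶ A) ≫ (baseMap zν : A ⟶ A)
    rw [h₂, h₂', hb]
  · have e₁ : (div ((R.toRlfModel Ψ).map zμ ≫ K') : R.rlf.obj (op A)) =
        (R.rlf.map (baseMap zμ).op).hom K.div * ((R.ofBaseData Ψ).η.app (op A)).hom (div zμ) ^ ((1 : ℕ+) : ℕ) := rfl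
    have e₂ : (div (K ≫ (R.toRlfModel Ψ).map zν) : R.rlf.obj (op A)) =
        (R.rlf.map (baseMap K).op).hom (((R.ofBaseData Ψ).η.app (op A)).hom (div zν)) * K.div ^ (degFr zν : ℕ) := rfl
    change (div ((R.toRlfModel Ψ).map zμ ≫ K') : R.rlf.obj (op A)) = div (K ≫ (R.toRlfModel Ψ).map zν)
    rw [e₁, e₂, h₂, h₃, h₁', h₃', hb]
    simp only [PNat.one_coe, pow_one, op_id, CategoryTheory.Functor.map_id, CommMonCat.hom_id, MonoidHom.id_apply]
    exact mul_comm _ _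

/-- **Reading off a conjugation square.** If `G z_μ ≫ k' = k ≫ G z_ν` with `z_μ = (1, id, w, 0)`, `z_ν = (1, id, w, 0)`
then `deg_Fr k' = deg_Fr k`, `Base k' = Base k`, and
`Div k' · ι(w)^{deg_Fr k'} = Φ^rlf(Base k)(ι w) · Div k` in `Φ^rlf(A)`. [cite: MochizukiFrdI2008, Thm. 5.2 (i) p.100] -/
theorem components_of_conj (A : D) (μ ν : Algebra.GrothendieckGroup (Φ.obj (op A))) (w : Φ.obj (op A))
    (zμ : (⟨A, μ⟩ : Ψ.ModelOf) ⟶ ⟨A, μ * Algebra.GrothendieckGroup.of w⟩)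
    (hzμ : degFr zμ = 1 ∧ baseMap zμ = 𝟙 A ∧ div zμ = w ∧ unit zμ = 1)
    (zν : (⟨A, ν⟩ : Ψ.ModelOf) ⟶ ⟨A, ν * Algebra.GrothendieckGroup.of w⟩)
    (hzν : degFr zν = 1 ∧ baseMap zν = 𝟙 A ∧ div zν = w ∧ unit zν = 1)
    (k : (⟨A, gpApp (R.ofBaseData Ψ).η (op A) μ⟩ : (R.realSpan Ψ).ModelOf) ⟶ ⟨A, gpApp (R.ofBaseData Ψ).η (op A) ν⟩)
    (k' : (⟨A, gpApp (R.ofBaseData Ψ).η (op A) (μ * Algebra.GrothendieckGroup.of w)⟩ : (R.realSpan Ψ).ModelOf) ⟶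
      ⟨A, gpApp (R.ofBaseData Ψ).η (op A) (ν * Algebra.GrothendieckGroup.of w)⟩)
    (hsq : (R.toRlfModel Ψ).map zμ ≫ k' = k ≫ (R.toRlfModel Ψ).map zν) :
    degFr k' = degFr k ∧ baseMap k' = baseMap k ∧
      div k' * ((R.ofBaseData Ψ).η.app (op A)).hom w ^ (degFr k' : ℕ) =
        (R.rlf.map (baseMap k).op).hom (((R.ofBaseData Ψ).η.app (op A)).hom w) * div k := by
  obtain ⟨h₁, h₂, h₃, -⟩ := hzμ
  obtain ⟨h₁', h₂', h₃', -⟩ := hzν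
  have hdeg : degFr k' * degFr zμ = degFr zν * degFr k := congrArg degFr hsq
  rw [h₁, h₁', mul_one, one_mul] at hdeg
  have hbase : (baseMap zμ : A ⟶ A) ≫ (baseMap k' : A ⟶ A) = (baseMap k : A ⟶ A) ≫ (baseMap zν : A ⟶ A) :=
    congrArg baseMap hsq
  rw [h₂, h₂', Category.id_comp, Category.comp_id] at hbase
  have hdiv : (R.rlf.map (baseMap zμ).op).hom (div k') * ((R.ofBaseData Ψ).η.app (op A)).hom (div zμ) ^ (degFr k' : ℕ) =
      (R.rlf.map (baseMap k).op).hom (((R.ofBaseData Ψ).η.app (op A)).hom (div zν)) * div k ^ (degFr zν : ℕ) :=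
    congrArg div hsq
  rw [h₂, h₃, h₁', h₃', PNat.one_coe, pow_one, op_id, R.rlf.map_id, CommMonCat.hom_id, MonoidHom.id_apply] at hdiv
  exact ⟨hdeg, hbase, hdiv⟩

end FrdI.Cor54Sub

end Literature.AlgebraicGeometry.Frobenioids

end
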